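import Summits.NavierStokesRegularity.NavierStokesRegularity.Theorems.DirectionEnergyUntwistedAncientLiouvilleRepr
import Literature.Analysis.FluidPDE.OseenMildUniqueness
import Literature.Analysis.FluidPDE.KNSSOseenMildDecayTools
import HarnessLib

/-!
# Route DirectionEnergy, item `UntwistedAncientLiouville` — II: forward propagation of translation invariance

Helper file for item stmt-NavierStokesRegularity-2893 (`DirectionEnergy.UntwistedAncientLiouville`):
in the duality-form class of bounded ancient mild solutions (jointly continuous members),
translation invariance of one slice propagates to all later slices — the step "by the unique
local existence theorem of mild solution in [GIM], the solution stays two-dimensional" of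
Giga–Miura's Proposition 2.2, through the Oseen-mild representative of file I
(`UntwistedAncient.exists_oseen_repr`) and the uniqueness of bounded Oseen-mild solutions
(`oseenMild_bounded_unique`, KNSS 2009 §4).

## References

* Y. Giga, H. Miura, Comm. Math. Phys. 303 (2011) 289–300, Prop. 2.2 (proof). [GigaMiura2011]
* G. Koch, N. Nadirashvili, G. Seregin, V. Šverák, Acta Math. 203 (2009) 83–105 =
  arXiv:0709.3599, §4 (4.3)–(4.4). [KochNadirashviliSereginSverak2009]
-/

set_option linter.dupNamespace false

noncomputable section

open MeasureTheory Set Function Filter Module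
open scoped RealInnerProductSpace ContDiff

namespace Summit.NavierStokesRegularity.NavierStokesRegularity.Theorems

namespace UntwistedAncient

open Literature.Analysis Literature.Analysis.FluidPDE

/-- **Translation invariance of one slice propagates to all later slices** in the duality-form
class (Giga–Miura 2011, proof of Prop. 2.2: "by the unique local existence theorem of mild
solution in [GIM], the solution stays two-dimensional"; KNSS 2009 §4 (4.3)–(4.4), uniqueness of
bounded mild solutions). Let `v` be a bounded ancient mild solution (`ν = 1`, duality form),
jointly continuous on `(−∞, 0) × ℝ³`, with `v(s, · + b) = v(s, ·)`. Then
`v(t, · + b) = v(t, ·)` for every `s < t < 0`. Proof: pass to the Oseen-mild representative `W`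
of `exists_oseen_repr` on the window based at `s − 1`; the invariance of `v(s)` is that of
`W(1)` (the two differ by a Galilean change of frame), the translate `W(·, · + b)` solves the same
Oseen integral equation from time `1` (`heatExtension_comp_add_right_apply`,
`oseenDuhamel_comp_add_right`), so it agrees with `W` a.e. at every later time
(`oseenMild_bounded_unique`), everywhere by continuity, and the invariance of `W(t − s + 1)` is
that of `v(t)`. [cite: KochNadirashviliSereginSverak2009, §4 (4.3)–(4.4) (arXiv:0709.3599 p. 8); GigaMiura2011, Prop. 2.2 (proof)] -/
theorem translationInvariant_after
    {v : ℝ → EuclideanSpace ℝ (Fin 3) → EuclideanSpace ℝ (Fin 3)}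
    (hv : IsBoundedAncientMildSolution 1 v)
    (hcont : ContinuousOn (uncurry v) (Iio 0 ×ˢ univ))
    {s : ℝ} {b : EuclideanSpace ℝ (Fin 3)} (hb : ∀ x, v s (x + b) = v s x)
    {t : ℝ} (hst : s < t) (ht : t < 0) : ∀ x, v t (x + b) = v t x := by
  -- the window based at `a = s - 1`; `v(s)` sits at window time `1`, `v(t)` at `t - s + 1`
  set a : ℝ := s - 1 with ha_def
  have hs0 : s < 0 := hst.trans ht
  have ha : a < 0 := by rw [ha_def]; linarith
  obtain ⟨W, B, N, hWm, hWN, hWs, hmild, hident⟩ := exists_oseen_repr hv hcont ha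
  have h1win : (1 : ℝ) ∈ Ioo 0 (-a) := ⟨one_pos, by rw [ha_def]; linarith⟩
  set τ : ℝ := t - a with hτ_def
  have hτwin : τ ∈ Ioo 0 (-a) := ⟨by rw [hτ_def, ha_def]; linarith, by rw [hτ_def]; linarith⟩
  have h1τ : (1 : ℝ) < τ := by rw [hτ_def, ha_def]; linarith
  have hN0 : 0 ≤ N := (norm_nonneg _).trans (hWN 1 h1win 0)
  -- the invariance of `v(s)` is that of `W(1)`
  have hsa : (1 : ℝ) + a = s := by rw [ha_def]; ring
  have hW1 : ∀ z, W 1 (z + b) = W 1 z := by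
    intro z
    have h := hident 1 h1win (z + B 1 + b) (z + B 1)
    rw [hsa, hb, sub_self, show z + B 1 + b - B 1 = z + b by abel, add_sub_cancel_right] at h
    exact (sub_eq_zero.1 h.symm)
  -- the translate solves the same Oseen integral equation from time `1`
  set Wb : ℝ → EuclideanSpace ℝ (Fin 3) → EuclideanSpace ℝ (Fin 3) := fun σ y => W σ (y + b)
    with hWb
  have hW1fun : (fun y => W 1 (y + b)) = W 1 := funext hW1
  have hWm' : AEStronglyMeasurable (uncurry W)
      ((volume : Measure (ℝ × EuclideanSpace ℝ (Fin 3))).restrict (Ioo 1 (-a) ×ˢ univ)) :=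
    hWm.aestronglyMeasurable
  have hWbm : AEStronglyMeasurable (uncurry Wb)
      ((volume : Measure (ℝ × EuclideanSpace ℝ (Fin 3))).restrict (Ioo 1 (-a) ×ˢ univ)) := by
    have hshear : Measurable fun q : ℝ × EuclideanSpace ℝ (Fin 3) => (q.1, q.2 + b) :=
      measurable_fst.prodMk (measurable_snd.add_const b)
    have : uncurry Wb = uncurry W ∘ fun q : ℝ × EuclideanSpace ℝ (Fin 3) => (q.1, q.2 + b) := by
      funext q; rfl
    rw [this]
    exact (hWm.comp hshear).aestronglyMeasurable
  have hWM : ∀ σ ∈ Ioo 1 (-a), ∀ y, ‖W σ y‖ ≤ N := fun σ hσ y =>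
    hWN σ ⟨one_pos.trans hσ.1, hσ.2⟩ y
  have hWbM : ∀ σ ∈ Ioo 1 (-a), ∀ y, ‖Wb σ y‖ ≤ N := fun σ hσ y =>
    hWN σ ⟨one_pos.trans hσ.1, hσ.2⟩ (y + b)
  have hWeq : ∀ σ ∈ Ioo 1 (-a), W σ =ᵐ[volume] fun y =>
      UnboundedOperators.heatExtension (W 1) (σ - 1) y - oseenDuhamel 1 1 W W σ y :=
    fun σ hσ => Eventually.of_forall fun y => hmild 1 σ one_pos hσ.1 hσ.2 y
  have hWbeq : ∀ σ ∈ Ioo 1 (-a), Wb σ =ᵐ[volume] fun y =>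
      UnboundedOperators.heatExtension (W 1) (σ - 1) y - oseenDuhamel 1 1 Wb Wb σ y := by
    intro σ hσ
    refine Eventually.of_forall fun y => ?_
    show W σ (y + b) = UnboundedOperators.heatExtension (W 1) (σ - 1) y -
      oseenDuhamel 1 1 (fun σ y => W σ (y + b)) (fun σ y => W σ (y + b)) σ y
    rw [oseenDuhamel_comp_add_right, hmild 1 σ one_pos hσ.1 hσ.2 (y + b),
      ← heatExtension_comp_add_right_apply, hW1fun]
  have hae := oseenMild_bounded_unique one_pos hN0 hWm' hWbm hWM hWbM hWeq hWbeq τ ⟨h1τ, hτwin.2⟩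
  -- everywhere, by continuity of the slices
  have hWc : Continuous (W τ) := (hWs τ hτwin).continuous
  have hWbc : Continuous (Wb τ) := hWc.comp (continuous_id.add continuous_const)
  have heq := (Continuous.ae_eq_iff_eq volume hWc hWbc).1 hae
  have hWτ : ∀ z, W τ (z + b) = W τ z := fun z => (congr_fun heq z).symm
  -- back to `v(t)`
  have hta : τ + a = t := by rw [hτ_def]; ring
  intro x
  have h := hident τ hτwin (x + b) x
  rw [hta, show x + b - B τ = (x - B τ) + b by abel, hWτ, sub_self] at h
  exact sub_eq_zero.1 h

end UntwistedAncient

end Summit.NavierStokesRegularity.NavierStokesRegularity.Theorems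

end
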